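import Summits.FinalStateConjecture.FinalStateConjecture.Theses.ZeroEnergyKerrOrBomb
import Summits.FinalStateConjecture.FinalStateConjecture.Theorems.KerrOrBomb.Negative.ModeStabilityAnatomy
import Literature.Geometry.Lorentzian.KillingModeStability
import Literature.Geometry.Lorentzian.ZeroEnergyRayTrappedModFlow
import Literature.Geometry.Lorentzian.GeodesicProofs
import Literature.Geometry.Lorentzian.StationaryBlackHoleUniquenessProofs

/-!
# `ErgoregionBombModT` (crux `stmt-FinalStateConjecture-17838`, route `ZeroEnergyKerrOrBomb`):
# anatomy of the antecedent (negative-side load-bearing analysis)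

Support file of the crux disprover (cdisprove seat `refuter-cdisprove-stmt-FinalStateConjecture-17838-0`,
cycle 1, 2026-08-17), `sorry`-free; workfile `Cruxes/ErgoregionBombModT/Disproof.lean` §0–§4. The crux
reads `∀ 𝓑, (telescope: vacuum, I⁺-regular, future-presented, T ≠ 0 on a simply connected d.o.c.,
Killing–timelike collar (U, K) on a connected horizon, closed ergoregion off U compact mod T) →
∀ S compact ⊆ doc, ∀ γ s, maximal geodesic γ on s ≠ ∅ with g(γ̇,γ̇) = 0, γ̇ ≠ 0, g(γ̇,T) = 0 on s
and γ(s) ⊆ ⋃_σ φ_σ(S) → ∃ growing Killing-mode pair (ν > 0)`. This file records, for EVERY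
presentation `𝓑 : StationaryAFBlackHole`:

* `ergoregionBombModT_iff` — the crux is (currying only) `∀ telescope 𝓑,
  𝓑.HasZeroEnergyRayTrappedModFlow → ¬ 𝓑.IsKillingModeStable` through the tree predicates of
  `ZeroEnergyRayTrappedModFlow.lean` / `KillingModeStability.lean`;
* `stationaryOrbit_subset_doc`, `not_hasZeroEnergyRayTrappedModFlow_of_isTimelike_on_doc` — the
  trapped ray runs in `doc ∩ {g(T,T) ≥ 0}`; a hole with `T` timelike on its d.o.c. has no antecedent
  (the instance of the crux there is vacuous: where the non-rotating branch ends);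
* `hasZeroEnergyRayTrappedModFlow_of_nullGeodesicOrbit` — the MINIMAL antecedent: a null geodesic
  `T`-orbit through a d.o.c. point (a Killing light point) is a complete zero-energy null geodesic
  trapped mod `T` with `S = {x}`; any proof of the crux must bomb this configuration;
* `constCurve_isMaximalGeodesicOn`, `ergoregionBombModT_withoutVelocity_iff` — the clause `γ̇ ≠ 0`
  (spelled out at rev 6) is LOAD-BEARING: the constant curve at a d.o.c. point meets every other
  clause of the antecedent, so the crux with `γ̇ ≠ 0` deleted is equivalent to "every telescope hole
  is Killing-mode-unstable" — false as soon as one telescope hole (sub-extremal Kerr, Whiting 1989 /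
  Shlapentokh-Rothman 2015 Thm 1.5, support item `KerrModeStability`) is mode stable, and it would make
  the target `KerrOrBombModT` vacuous;
* `conclusion_not_docBounded` — any witness of the conclusion is UNBOUNDED on the d.o.c. (landed
  growth law, `KerrOrBomb.Negative.modePair_eq_zero_of_bounded_on_doc`): the restriction of the bound
  to `doc ∩ I⁻(far slice region)` is load-bearing and the mode must blow up towards the future.

References: B. O'Neill, *Semi-Riemannian geometry* (1983), Ch. 3 p. 69, Ch. 5 Lemma 5.26;
P. T. Chruściel, J. L. Costa, Astérisque 321 (2008), §2.2; Y. Shlapentokh-Rothman, AHP 16 (2015) 289,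
Thm 1.5; A. D. Ionescu, S. Klainerman, Surveys in Differential Geometry 20 (2015), §4.
-/

noncomputable section

set_option linter.dupNamespace false
-- instance search through nested operator types `E →L E →L ℝ` (as in the tree files)
set_option maxSynthPendingDepth 3

namespace Summit.FinalStateConjecture.FinalStateConjecture.Theorems.ErgoregionBombModT.Negative

open Set Bundle Literature.Geometry.Lorentzian
open scoped Manifold Topology
open Summit.FinalStateConjecture.FinalStateConjecture.Theses.ZeroEnergyKerrOrBomb (ErgoregionBombModT)

/-! ## The crux bundled through the tree predicates -/

/-- **`ErgoregionBombModT` is equivalent to**: every telescope hole with a zero-energy null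
geodesic trapped modulo the stationary flow (`HasZeroEnergyRayTrappedModFlow`) is NOT Killing-mode
stable (`IsKillingModeStable`). The telescope binders are verbatim; pure currying over
`not_isKillingModeStable_iff_exists_isKillingModePair`. [cite: IonescuKlainerman2015, §4] -/
theorem ergoregionBombModT_iff : ErgoregionBombModT ↔
    ∀ (𝓑 : StationaryAFBlackHole.{0}) [𝓑.metric.HasLeviCivita] [Kerr.Facts],
      𝓑.metric.toPseudoRiemannianMetric.IsRicciFlat → 𝓑.IsIPlusRegular →
      (∀ p : 𝓑.carrier, p ∈ 𝓑.metric.chronologicalFuture 𝓑.timeOrientation 𝓑.Mext) →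
      (∀ p ∈ 𝓑.doc, 𝓑.killing p ≠ 0) → SimplyConnectedSpace 𝓑.doc →
      ∀ (U : Set 𝓑.carrier) (K : Π x : 𝓑.carrier, TangentSpace (𝓡 4) x), IsOpen U →
      𝓑.horizon ⊆ U → IsConnected 𝓑.horizon →
      ContMDiffOn (𝓡 4) ((𝓡 4).prod 𝓘(ℝ, E4)) ((⊤ : ℕ∞) : WithTop ℕ∞)
        (fun x ↦ (TotalSpace.mk' E4 x (K x) : TangentBundle (𝓡 4) 𝓑.carrier)) U →
      (∀ x ∈ U, ∀ v w : TangentSpace (𝓡 4) x, 𝓑.metric.val x (𝓑.metric.leviCivita K x v) w +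
        𝓑.metric.val x v (𝓑.metric.leviCivita K x w) = 0) →
      (∀ x ∈ U, VectorField.mlieBracket (𝓡 4) 𝓑.killing K x = 0) → (∀ p ∈ 𝓑.horizon, K p ≠ 0) →
      (∀ γ : ℝ → 𝓑.carrier, IsMIntegralCurve γ K → γ 0 ∈ 𝓑.horizon → ∀ t, γ t ∈ 𝓑.horizon) →
      (∀ x ∈ U ∩ 𝓑.doc, 𝓑.metric.val x (K x) (K x) < 0) →
      (∃ S₀ : Set 𝓑.carrier, IsCompact S₀ ∧ S₀ ⊆ 𝓑.doc ∧ ∀ y ∈ 𝓑.doc,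
        0 ≤ 𝓑.metric.val y (𝓑.killing y) (𝓑.killing y) → y ∉ U →
          y ∈ stationaryOrbit 𝓑.killing S₀) →
      𝓑.HasZeroEnergyRayTrappedModFlow → ¬ 𝓑.IsKillingModeStable := by
  unfold ErgoregionBombModT
  constructor
  · rintro h 𝓑 _ _ h1 h2 h3 h4 h5 U K hU hHU hc hK hKi hbr hK0 htan htl hbelt
      ⟨S, hS, hSd, γ, s, hγ, hs, hz, hin⟩
    rw [StationaryAFBlackHole.not_isKillingModeStable_iff_exists_isKillingModePair]
    obtain ⟨ν, ω, ψ, χ, hν, hU', hW, hE, hB, hx⟩ :=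
      h 𝓑 h1 h2 h3 h4 h5 U K hU hHU hc hK hKi hbr hK0 htan htl hbelt S hS hSd γ s hγ hs hz hin
    exact ⟨ν, ω, ψ, χ, hν, ⟨hU', hW, hE, hB⟩, hx⟩
  · intro h 𝓑 _ _ h1 h2 h3 h4 h5 U K hU hHU hc hK hKi hbr hK0 htan htl hbelt S hS hSd γ s hγ hs hz hin
    have := h 𝓑 h1 h2 h3 h4 h5 U K hU hHU hc hK hKi hbr hK0 htan htl hbelt
      ⟨S, hS, hSd, γ, s, hγ, hs, hz, hin⟩
    rw [StationaryAFBlackHole.not_isKillingModeStable_iff_exists_isKillingModePair] at this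
    obtain ⟨ν, ω, ψ, χ, hν, ⟨hU', hW, hE, hB⟩, hx⟩ := this
    exact ⟨ν, ω, ψ, χ, hν, hU', hW, hE, hB, hx⟩

variable (𝓑 : StationaryAFBlackHole.{0}) [𝓑.metric.HasLeviCivita]

/-! ## Localisation of the trapped ray -/

/-- **The `T`-orbit of a subset of the d.o.c. stays in the d.o.c.** (flow-invariance of
`⟨⟨M_ext⟩⟩`, `StationaryAFBlackHole.mem_doc_of_isMIntegralCurve`); in particular every point of the
antecedent's geodesic lies in `doc`. [cite: ChruscielCosta2008, §2.2 (2.2)] -/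
theorem stationaryOrbit_subset_doc {S : Set 𝓑.carrier} (hSd : S ⊆ 𝓑.doc) :
    stationaryOrbit 𝓑.killing S ⊆ 𝓑.doc := by
  rintro y ⟨σ, hσ, h0, t, rfl⟩
  exact StationaryAFBlackHole.mem_doc_of_isMIntegralCurve hσ (hSd h0) t

/-- **No ergoregion in the d.o.c., no antecedent**: if `T` is timelike at every point of `doc`
then `¬ 𝓑.HasZeroEnergyRayTrappedModFlow` (a non-zero null vector is never orthogonal to a timelike
one, tree lemma `not_hasZeroEnergyRayTrappedModFlow_of_isTimelike`, plus flow-invariance of `doc`),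
so the instance of the crux at such a hole holds VACUOUSLY. This is where the non-rotating branch ends
(K ∥ T on 𝓔⁺ ⇒ staticity ⇒ `T` timelike on `doc`), and why a countermodel needs an ergoregion
reaching into `⟨⟨M_ext⟩⟩`. [cite: ONeill1983, Ch. 5, Lemma 5.26] -/
theorem not_hasZeroEnergyRayTrappedModFlow_of_isTimelike_on_doc
    (hT : ∀ p ∈ 𝓑.doc, 𝓑.metric.IsTimelike (𝓑.killing p)) :
    ¬ 𝓑.HasZeroEnergyRayTrappedModFlow :=
  𝓑.not_hasZeroEnergyRayTrappedModFlow_of_isTimelike fun _ _ hSd x hx ↦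
    hT x (stationaryOrbit_subset_doc 𝓑 hSd hx)

/-! ## The minimal antecedent: a null geodesic stationary orbit -/

omit [𝓑.metric.HasLeviCivita] in
/-- The velocity of an integral curve of `T` is `T`. [folklore] -/
private theorem velocity_of_isMIntegralCurve_killing {σ : ℝ → 𝓑.carrier}
    (hσ : IsMIntegralCurve σ 𝓑.killing) (t : ℝ) : velocity (𝓡 4) σ t = 𝓑.killing (σ t) := by
  rw [velocity, (hσ t).mfderiv]
  change ((1 : ℝ →L[ℝ] ℝ) (1 : ℝ)) • 𝓑.killing (σ t) = 𝓑.killing (σ t)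
  simp

/-- **Killing light points must bomb.** If the `T`-orbit `σ` through a point of the d.o.c. is a
null GEODESIC (`g(T, T) = 0` along it and `σ` is a geodesic of the Levi-Civita connection — i.e.
`σ 0` is a critical point of `g(T,T)` on the ergosurface; affinely parametrised by Killing time, hence
complete), then `𝓑.HasZeroEnergyRayTrappedModFlow` holds with `S = {σ 0}`, `s = univ`: the orbit
is a maximal null geodesic (`IsGeodesic.isMaximalGeodesicOn_univ`), `γ̇ = T ≠ 0` on `doc`, and
`g(γ̇, T) = g(T, T) = 0`. Kerr has no such orbit (its ergosurface is a regular level set of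
`g(T,T)`); the crux must nevertheless produce a growing mode from this configuration alone.
[cite: IonescuKlainerman2015, §4] -/
theorem hasZeroEnergyRayTrappedModFlow_of_nullGeodesicOrbit
    (h5 : ∀ p ∈ 𝓑.doc, 𝓑.killing p ≠ 0) {σ : ℝ → 𝓑.carrier}
    (hσ : IsMIntegralCurve σ 𝓑.killing) (h0 : σ 0 ∈ 𝓑.doc)
    (hgeo : IsGeodesic 𝓑.metric.toPseudoRiemannianMetric.leviCivita σ)
    (hnull : ∀ t, 𝓑.metric.val (σ t) (𝓑.killing (σ t)) (𝓑.killing (σ t)) = 0) :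
    𝓑.HasZeroEnergyRayTrappedModFlow := by
  have hdoc : ∀ t, σ t ∈ 𝓑.doc := fun t ↦
    StationaryAFBlackHole.mem_doc_of_isMIntegralCurve hσ h0 t
  refine ⟨{σ 0}, isCompact_singleton, by simpa using h0, σ, univ,
    IsGeodesic.isMaximalGeodesicOn_univ _ hgeo, univ_nonempty, fun t _ ↦ ?_, fun t _ ↦ ?_⟩
  · rw [velocity_of_isMIntegralCurve_killing 𝓑 hσ t]
    exact ⟨hnull t, h5 _ (hdoc t), hnull t⟩
  · exact ⟨σ, hσ, rfl, t, rfl⟩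

/-! ## The clause `γ̇ ≠ 0` is load-bearing -/

/-- **The constant curve at a point of the d.o.c. meets every clause of the antecedent except
`γ̇ ≠ 0`**: it is a maximal geodesic with domain `univ` (constant curves are geodesics,
`isGeodesic_const_holds`; a geodesic on `ℝ` is maximal), `g(γ̇, γ̇) = g(γ̇, T) = 0` since `γ̇ = 0`
(`mfderiv_const`), and it lies in the `T`-orbit of the compact set `{x} ⊆ doc` (`T` is complete).
[cite: ONeill1983, Ch. 3, p. 69] -/
theorem constCurve_isMaximalGeodesicOn {x : 𝓑.carrier} (hx : x ∈ 𝓑.doc) :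
    IsCompact ({x} : Set 𝓑.carrier) ∧ ({x} : Set 𝓑.carrier) ⊆ 𝓑.doc ∧
    IsMaximalGeodesicOn 𝓑.metric.toPseudoRiemannianMetric.leviCivita (fun _ : ℝ ↦ x) univ ∧
    (univ : Set ℝ).Nonempty ∧
    (∀ t ∈ (univ : Set ℝ),
      𝓑.metric.val x (velocity (𝓡 4) (fun _ : ℝ ↦ x) t) (velocity (𝓡 4) (fun _ : ℝ ↦ x) t) = 0 ∧
      𝓑.metric.val x (velocity (𝓡 4) (fun _ : ℝ ↦ x) t) (𝓑.killing x) = 0) ∧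
    ∀ t ∈ (univ : Set ℝ), (fun _ : ℝ ↦ x) t ∈ stationaryOrbit 𝓑.killing {x} := by
  have hv : ∀ t, velocity (𝓡 4) (fun _ : ℝ ↦ x) t = 0 := fun t ↦ by
    simp only [velocity, mfderiv_const]
    rfl
  refine ⟨isCompact_singleton, by simpa using hx,
    IsGeodesic.isMaximalGeodesicOn_univ _
      (isGeodesic_const_holds 𝓑.metric.toPseudoRiemannianMetric.leviCivita x),
    univ_nonempty, fun t _ ↦ ?_, fun t _ ↦ ?_⟩
  · simp [hv]
  · exact subset_stationaryOrbit 𝓑.isStationaryKilling.isCompleteVectorField _ rfl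

/-- **Without `γ̇ ≠ 0` the crux says "every telescope hole is Killing-mode-unstable".** Left: the
crux with the conjunct `velocity (𝓡 4) γ t ≠ 0` deleted from its antecedent (telescope binders and
conclusion verbatim, the latter bundled as `¬ IsKillingModeStable`); right: the telescope binders
alone imply mode INstability. (⇒: the constant curve at a point of the non-empty d.o.c.,
`constCurve_isMaximalGeodesicOn`, `StationaryAFBlackHole.doc_nonempty`.) Hence the left side is false
as soon as ONE telescope hole is mode stable — sub-extremal Kerr with the collar `∂_{t*} + Ω_H ∂_{φ*}`
(Whiting 1989 / Shlapentokh-Rothman 2015, Thm 1.5; support item `KerrModeStability`) — and it would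
make the route's target `KerrOrBombModT` vacuously true: the rev-6 conjunct `γ̇ ≠ 0` is exactly what
keeps the dichotomy honest. [cite: ShlapentokhRothman2015ModeStability, Thm. 1.5] -/
theorem ergoregionBombModT_withoutVelocity_iff :
    (∀ (𝓑 : StationaryAFBlackHole.{0}) [𝓑.metric.HasLeviCivita] [Kerr.Facts],
      𝓑.metric.toPseudoRiemannianMetric.IsRicciFlat → 𝓑.IsIPlusRegular →
      (∀ p : 𝓑.carrier, p ∈ 𝓑.metric.chronologicalFuture 𝓑.timeOrientation 𝓑.Mext) →
      (∀ p ∈ 𝓑.doc, 𝓑.killing p ≠ 0) → SimplyConnectedSpace 𝓑.doc →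
      ∀ (U : Set 𝓑.carrier) (K : Π x : 𝓑.carrier, TangentSpace (𝓡 4) x), IsOpen U →
      𝓑.horizon ⊆ U → IsConnected 𝓑.horizon →
      ContMDiffOn (𝓡 4) ((𝓡 4).prod 𝓘(ℝ, E4)) ((⊤ : ℕ∞) : WithTop ℕ∞)
        (fun x ↦ (TotalSpace.mk' E4 x (K x) : TangentBundle (𝓡 4) 𝓑.carrier)) U →
      (∀ x ∈ U, ∀ v w : TangentSpace (𝓡 4) x, 𝓑.metric.val x (𝓑.metric.leviCivita K x v) w +
        𝓑.metric.val x v (𝓑.metric.leviCivita K x w) = 0) →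
      (∀ x ∈ U, VectorField.mlieBracket (𝓡 4) 𝓑.killing K x = 0) → (∀ p ∈ 𝓑.horizon, K p ≠ 0) →
      (∀ γ : ℝ → 𝓑.carrier, IsMIntegralCurve γ K → γ 0 ∈ 𝓑.horizon → ∀ t, γ t ∈ 𝓑.horizon) →
      (∀ x ∈ U ∩ 𝓑.doc, 𝓑.metric.val x (K x) (K x) < 0) →
      (∃ S₀ : Set 𝓑.carrier, IsCompact S₀ ∧ S₀ ⊆ 𝓑.doc ∧ ∀ y ∈ 𝓑.doc,
        0 ≤ 𝓑.metric.val y (𝓑.killing y) (𝓑.killing y) → y ∉ U →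
          y ∈ stationaryOrbit 𝓑.killing S₀) →
      ∀ S : Set 𝓑.carrier, IsCompact S → S ⊆ 𝓑.doc → ∀ (γ : ℝ → 𝓑.carrier) (s : Set ℝ),
      IsMaximalGeodesicOn 𝓑.metric.toPseudoRiemannianMetric.leviCivita γ s → s.Nonempty →
      (∀ t ∈ s, 𝓑.metric.val (γ t) (velocity (𝓡 4) γ t) (velocity (𝓡 4) γ t) = 0 ∧
        𝓑.metric.val (γ t) (velocity (𝓡 4) γ t) (𝓑.killing (γ t)) = 0) →
      (∀ t ∈ s, γ t ∈ stationaryOrbit 𝓑.killing S) → ¬ 𝓑.IsKillingModeStable) ↔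
    ∀ (𝓑 : StationaryAFBlackHole.{0}) [𝓑.metric.HasLeviCivita] [Kerr.Facts],
      𝓑.metric.toPseudoRiemannianMetric.IsRicciFlat → 𝓑.IsIPlusRegular →
      (∀ p : 𝓑.carrier, p ∈ 𝓑.metric.chronologicalFuture 𝓑.timeOrientation 𝓑.Mext) →
      (∀ p ∈ 𝓑.doc, 𝓑.killing p ≠ 0) → SimplyConnectedSpace 𝓑.doc →
      ∀ (U : Set 𝓑.carrier) (K : Π x : 𝓑.carrier, TangentSpace (𝓡 4) x), IsOpen U →
      𝓑.horizon ⊆ U → IsConnected 𝓑.horizon →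
      ContMDiffOn (𝓡 4) ((𝓡 4).prod 𝓘(ℝ, E4)) ((⊤ : ℕ∞) : WithTop ℕ∞)
        (fun x ↦ (TotalSpace.mk' E4 x (K x) : TangentBundle (𝓡 4) 𝓑.carrier)) U →
      (∀ x ∈ U, ∀ v w : TangentSpace (𝓡 4) x, 𝓑.metric.val x (𝓑.metric.leviCivita K x v) w +
        𝓑.metric.val x v (𝓑.metric.leviCivita K x w) = 0) →
      (∀ x ∈ U, VectorField.mlieBracket (𝓡 4) 𝓑.killing K x = 0) → (∀ p ∈ 𝓑.horizon, K p ≠ 0) →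
      (∀ γ : ℝ → 𝓑.carrier, IsMIntegralCurve γ K → γ 0 ∈ 𝓑.horizon → ∀ t, γ t ∈ 𝓑.horizon) →
      (∀ x ∈ U ∩ 𝓑.doc, 𝓑.metric.val x (K x) (K x) < 0) →
      (∃ S₀ : Set 𝓑.carrier, IsCompact S₀ ∧ S₀ ⊆ 𝓑.doc ∧ ∀ y ∈ 𝓑.doc,
        0 ≤ 𝓑.metric.val y (𝓑.killing y) (𝓑.killing y) → y ∉ U →
          y ∈ stationaryOrbit 𝓑.killing S₀) →
      ¬ 𝓑.IsKillingModeStable := by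
  constructor
  · intro h 𝓑 _ _ h1 h2 h3 h4 h5 U K hU hHU hc hK hKi hbr hK0 htan htl hbelt
    obtain ⟨x, hx⟩ := 𝓑.doc_nonempty
    obtain ⟨hcpt, hxd, hmax, hne, hz, hin⟩ := constCurve_isMaximalGeodesicOn 𝓑 hx
    exact h 𝓑 h1 h2 h3 h4 h5 U K hU hHU hc hK hKi hbr hK0 htan htl hbelt {x} hcpt hxd
      (fun _ ↦ x) univ hmax hne hz hin
  · intro h 𝓑 _ _ h1 h2 h3 h4 h5 U K hU hHU hc hK hKi hbr hK0 htan htl hbelt _ _ _ _ _ _ _ _ _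
    exact h 𝓑 h1 h2 h3 h4 h5 U K hU hHU hc hK hKi hbr hK0 htan htl hbelt

/-! ## The boundedness region of the conclusion is load-bearing -/

variable {𝓑} in
/-- **Any witness of the crux's conclusion is unbounded on the d.o.c.**: a `ν > 0` pair, smooth
near `doc ∪ 𝓗⁺`, satisfying the eigen-equations on `doc`, non-zero somewhere on `doc`, is NOT
bounded on the whole d.o.c. (landed `KerrOrBomb.Negative.modePair_eq_zero_of_bounded_on_doc`: growth
law `ψ² + χ² = e^{2ν(t−t₀)}(ψ₀² + χ₀²)` along the complete forward `T`-orbits, which stay in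
`doc`). So the mode to be built blows up towards the future and meets its bound only on
`doc ∩ I⁻(far slice region)`; the conclusion with the bound widened to `doc` is unsatisfiable on
every presentation. [cite: ChruscielCosta2008, §2.2 (2.2)] -/
theorem conclusion_not_docBounded {ν ω : ℝ} {ψ χ : 𝓑.carrier → ℝ} (hν : 0 < ν)
    (hU : ∃ U : Set 𝓑.carrier, IsOpen U ∧ 𝓑.doc ∪ 𝓑.horizon ⊆ U ∧
      ContMDiffOn (𝓡 4) 𝓘(ℝ, ℝ) ((⊤ : ℕ∞) : WithTop ℕ∞) ψ U ∧
      ContMDiffOn (𝓡 4) 𝓘(ℝ, ℝ) ((⊤ : ℕ∞) : WithTop ℕ∞) χ U)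
    (heig : ∀ x ∈ 𝓑.doc, mfderiv (𝓡 4) 𝓘(ℝ, ℝ) ψ x (𝓑.killing x) = ν * ψ x - ω * χ x ∧
      mfderiv (𝓡 4) 𝓘(ℝ, ℝ) χ x (𝓑.killing x) = ω * ψ x + ν * χ x)
    (hx : ∃ x ∈ 𝓑.doc, ψ x ≠ 0 ∨ χ x ≠ 0) :
    ¬ ∃ C : ℝ, ∀ x ∈ 𝓑.doc, |ψ x| ≤ C ∧ |χ x| ≤ C := by
  intro hb
  obtain ⟨x, hxd, hx0⟩ := hx
  have h := KerrOrBomb.Negative.modePair_eq_zero_of_bounded_on_doc hν hU heig hb x hxd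
  rcases hx0 with h0 | h0
  · exact h0 h.1
  · exact h0 h.2

end Summit.FinalStateConjecture.FinalStateConjecture.Theorems.ErgoregionBombModT.Negative

end
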